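import Summits.QuantumFields.BalabanUV.InfraRed.StrongCouplingSUNFronts
import HarnessLib

/-!
# The variance door for `SU(N)`: the one-link modulus as a function of a NAMED variance bound, and the three fronts

Observatory of the non-perturbative crossover; no mass-gap claim.

ABSOLUTE RULE of this package: no internally-minted statement enters as a cited fact; every hypothesis is either
kernel-proved in this package or a verbatim quotation of a PUBLISHED theorem with page reference. The manuscript(s)
under audit are not citable for their own disputed steps. Everything below is kernel arithmetic over theorems of this
tree; the one new object is a HYPOTHESIS SCHEMA (a `def … : Prop`, nothing asserted).

WHAT THIS LEAF DOES.  The tree's hypothesis-free one-link modulus for `SU(N)`,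
`oneLinkKRModulus_SU : OneLinkKRModulus N R (1/(1/2 − R))`, is the covariance-form tilt interpolation in which BOTH
factors of `|Cov_{ν}(φ, w)| ≤ (Var φ · Var w)^{1/2}` are bounded by the Bakry–Émery Poincaré inequality
`haarPoincare_SU` (`Var ≤ M²/(N(1/2 − ‖B‖_op))` for `M`-Lipschitz observables).  For the test function `φ`
nothing better than Poincaré is available; but `w = N Re tr(g Δ)` is ONE linear observable, and its variance under
the tilted one-link law is a number that can be bounded directly (for `SU(2)` this is the variance lemma of
`StrongCouplingVarianceWindow`, J-SC8).  This leaf exposes that number as a named hypothesis for general `N`: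

* `OneLinkVarianceBound N R v` (schema): for every `B` with `‖B‖_op ≤ R` and every `Δ`,
  `Var_{ν_B}(N Re tr(g Δ)) ≤ v ‖Δ‖_F²`, `ν_B(dg) ∝ exp(N Re tr(g B)) dg` on `SU(N)`;
* `oneLinkKRModulus_of_varianceBound` (K): `OneLinkVarianceBound N R v`, `R < 1/2` ⟹
  `OneLinkKRModulus N R √(v/(N(1/2 − R)))`;
* `oneLinkVarianceBound_bakryEmery` (K): the schema holds with `v = N/(1/2 − R)` (Poincaré once more), and then the
  modulus above is `1/(1/2 − R)` again (identity `varianceModulus_bakryEmery_eq`) — consistency with the tree's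
  `oneLinkKRModulus_SU`, which is therefore not restated here;
* `strongCouplingFronts_SU_of_modulus` / `strongCouplingFronts_SU_of_varianceBound` (K): the three gauge-fixed doors
  of `StrongCouplingSUNFronts` (row constants `18`, `14223/1000`, `14`) fed with ANY modulus, resp. with the variance
  modulus: SC-a / SC-b / SC-c at tree coupling `β` as soon as `D (β/N) K < 1`;
* `SU(3)` CONDITIONAL instances (K, hypothesis displayed in the statement): IF `OneLinkVarianceBound 3 (6/25) (111/50)`
  THEN SC-b and SC-c hold at Wilson `β_W = 0.36` (`su3_fronts_036_of_varianceBound`); IF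
  `OneLinkVarianceBound 3 (21/100) (213/100)` THEN SC-a holds at `β_W = 0.315` (`su3_dlrMassGapAt_0315_of_varianceBound`).
  The values `v = (3/2)(1 + 2R)` at `R = 0.24`, `0.21` are an ENVELOPE suggested by a Monte Carlo reconnaissance of this
  lineage (kit job j100575: `sup Var/(3/2) ≈ 1.30, 1.44` at `R = 0.2, 0.3`; exact first order `1 + (3/2)R`, from
  `E_Haar[g_{ai} g_{bj} g_{ck}] = ε_{abc} ε_{ijk}/6`) — NUMERICS, NOT EVIDENCE: the hypothesis is a typed TARGET
  for a later two-engine certificate and kernel port, exactly as `OneLinkPoincareSU2 R c` was for `SU(2)`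
  (J-SC10 → J-SC13).

NOT CLAIMED: that `OneLinkVarianceBound 3 R v` holds for any `v < 3/(1/2 − R)`; any `SU(3)` window beyond the
hypothesis-free ones of `StrongCouplingSUNFronts` (`β_W < 3/16 ∕ 4500/20223 ∕ 9/40`); anything about `SU(2)`,
whose owned windows (`2/9 ∕ 4000/14223 ∕ 2/7`) rest on the sharper quarter modulus.  Necessary size of `v`
[analysis, not used]: at `B = 0` the Haar variance is `N ‖Δ‖_F²/2`, so `v ≥ N/2`.

## References

* H. Shen, R. Zhu, X. Zhu, *A stochastic analysis approach to lattice Yang–Mills at strong coupling*, CMP 400 (2023),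
  arXiv:2204.12737: Lemma 4.1, (4.4)–(4.6), Rem. 1.3 (the Bakry–Émery one-link bound); Cor. «Mass gap».
* H. Föllmer, *Random fields and diffusion processes*, LNM 1362 (1988), Thm. 2.13 (Dobrushin's covariance estimate).
* F. Mezzadri, *How to generate random matrices from the classical compact groups*, Notices AMS 54 (2007),
  arXiv:math-ph/0609050, §5 (the sampling method of the Monte Carlo reconnaissance only; never load-bearing).
-/

noncomputable section

open MeasureTheory ProbabilityTheory Real
open Literature.MathematicalPhysics.QuantumFieldTheory
open Literature.MathematicalPhysics.QuantumLattice (fundamentalRep fundamentalLatticeRep)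
open Literature.MathematicalPhysics.QuantumFieldTheory.Balaban1983to89
open Literature.MathematicalPhysics.QuantumFieldTheory.Balaban1983to89.StrongCouplingDobrushinWindow
open Literature.MathematicalPhysics.QuantumFieldTheory.Balaban1983to89.StrongCouplingTorusWindow (krRate krRate_pos)
open Literature.MathematicalPhysics.QuantumFieldTheory.Balaban1983to89.StrongCouplingKernelWindow
  (oneLinkKRModulus_SU abs_integral_tilted_add_sub_le_of_cov)
open Summit.QuantumFields.BalabanUV.InfraRed.StrongCouplingSlabAxialClustering (latticeMassGap_of_oneLinkKRModulus_axial)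
open Summit.QuantumFields.BalabanUV.InfraRed.StrongCouplingSUNFronts (strongCouplingFront_of_oneLinkKRModulus_sixteenClass)

namespace Summit.QuantumFields.BalabanUV.InfraRed.StrongCouplingVarianceDoorSUN

/-! ## 1. The schema and the modulus it gives -/

/-- **One-link variance bound** (HYPOTHESIS SCHEMA, nothing asserted): on the operator-norm ball `‖B‖_op ≤ R` of
`M_N(ℂ)`, the variance of the linear observable `g ↦ N Re tr(g Δ)` under the tilted one-link law
`ν_B(dg) ∝ exp(N Re tr(g B)) Haar(dg)` on `SU(N)` is at most `v ‖Δ‖_F²`, for every direction `Δ`.  Bakry–Émery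
gives it with `v = N/(1/2 − R)` (`oneLinkVarianceBound_bakryEmery`); the Haar point forces `v ≥ N/2`. [folklore] -/
@[conjecture]
def OneLinkVarianceBound (N : ℕ) (R v : ℝ) : Prop :=
  ∀ B : Matrix (Fin N) (Fin N) ℂ, matrixOpNorm B ≤ R → ∀ Δ : Matrix (Fin N) (Fin N) ℂ,
    Var[fun g : Matrix.specialUnitaryGroup (Fin N) ℂ => (N : ℝ) * ((g : Matrix (Fin N) (Fin N) ℂ) * Δ).trace.re ;
      (haarProbability (Matrix.specialUnitaryGroup (Fin N) ℂ)).tilted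
        fun g => (N : ℝ) * ((g : Matrix (Fin N) (Fin N) ℂ) * B).trace.re] ≤ v * frobNorm Δ ^ 2

/-- The schema is monotone: a bound on a larger ball with a smaller constant implies the bound on a smaller ball with
a larger constant. [folklore] -/
theorem OneLinkVarianceBound.mono {N : ℕ} {R R' v v' : ℝ} (h : OneLinkVarianceBound N R v) (hR : R' ≤ R)
    (hv : v ≤ v') : OneLinkVarianceBound N R' v' := fun B hB Δ =>
  (h B (hB.trans hR) Δ).trans (mul_le_mul_of_nonneg_right hv (sq_nonneg _))

/-- **Bakry–Émery inhabits the schema**: for `N ≥ 2` and `R < 1/2`, `OneLinkVarianceBound N R (N/(1/2 − R))` — the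
tree's `haarPoincare_SU` applied to the `N ‖Δ‖_F`-Lipschitz observable `N Re tr(g Δ)`.
[cite: arXiv220412737, Lemma 4.1 with (4.4)-(4.6) and Rem. 1.3] -/
theorem oneLinkVarianceBound_bakryEmery {N : ℕ} (hN : 2 ≤ N) {R : ℝ} (hR : R < 1 / 2) :
    OneLinkVarianceBound N R (N / (1 / 2 - R)) := by
  intro B hB Δ
  have hN0 : (0 : ℝ) < N := by exact_mod_cast (show 0 < N by omega)
  have hBlt : matrixOpNorm B < 1 / 2 := lt_of_le_of_lt hB hR
  have hM : 0 ≤ (N : ℝ) * frobNorm Δ := mul_nonneg hN0.le (frobNorm_nonneg _)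
  have hLip : ∀ a b : Matrix.specialUnitaryGroup (Fin N) ℂ,
      |(N : ℝ) * ((a : Matrix (Fin N) (Fin N) ℂ) * Δ).trace.re -
          (N : ℝ) * ((b : Matrix (Fin N) (Fin N) ℂ) * Δ).trace.re| ≤ (N : ℝ) * frobNorm Δ * suFrobDist a b := by
    intro a b
    rw [← mul_sub, abs_mul, abs_of_nonneg hN0.le, mul_assoc]
    refine mul_le_mul_of_nonneg_left ?_ hN0.le
    rw [mul_comm]
    exact abs_re_trace_su_mul_sub_le a b Δ
  have hvar := SUNBakryEmery.haarPoincare_SU hN B hBlt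
    (fun g => (N : ℝ) * ((g : Matrix (Fin N) (Fin N) ℂ) * Δ).trace.re) ((N : ℝ) * frobNorm Δ) hM hLip
  refine hvar.trans ?_
  have h1 : 0 < 1 / 2 - matrixOpNorm B := by linarith
  have h2 : 0 < 1 / 2 - R := by linarith
  rw [mul_pow, div_le_iff₀ (mul_pos hN0 h1)]
  have e1 : (N : ℝ) / (1 / 2 - R) * frobNorm Δ ^ 2 * ((N : ℝ) * (1 / 2 - R)) = (N : ℝ) ^ 2 * frobNorm Δ ^ 2 := by
    have e0 : (N : ℝ) / (1 / 2 - R) * (1 / 2 - R) = N := div_mul_cancel₀ _ h2.ne'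
    calc (N : ℝ) / (1 / 2 - R) * frobNorm Δ ^ 2 * ((N : ℝ) * (1 / 2 - R))
        = (N : ℝ) / (1 / 2 - R) * (1 / 2 - R) * N * frobNorm Δ ^ 2 := by ring
      _ = (N : ℝ) ^ 2 * frobNorm Δ ^ 2 := by rw [e0]; ring
  calc (N : ℝ) ^ 2 * frobNorm Δ ^ 2 = (N : ℝ) / (1 / 2 - R) * frobNorm Δ ^ 2 * ((N : ℝ) * (1 / 2 - R)) := e1.symm
    _ ≤ (N : ℝ) / (1 / 2 - R) * frobNorm Δ ^ 2 * ((N : ℝ) * (1 / 2 - matrixOpNorm B)) := by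
        refine mul_le_mul_of_nonneg_left (mul_le_mul_of_nonneg_left (by linarith) hN0.le) ?_
        exact mul_nonneg (div_nonneg hN0.le h2.le) (sq_nonneg _)

/-- **The variance modulus.**  `OneLinkVarianceBound N R v` with `R < 1/2`, `0 ≤ v` gives
`OneLinkKRModulus N R √(v/(N(1/2 − R)))`: the covariance form of the tilt interpolation
(`abs_integral_tilted_add_sub_le_of_cov`) along `B_t = B + t(B' − B)` (the ball is convex), Cauchy–Schwarz
(`abs_integral_mul_sub_le_of_variance_le`), the Bakry–Émery bound `Var_{ν_{B_t}}(φ) ≤ L²/(N(1/2 − R))` for the test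
function (`haarPoincare_SU`) and the HYPOTHESIS for the linear observable `w = N Re tr(g(B' − B))`:
`Var_{ν_{B_t}}(w) ≤ v ‖B' − B‖_F²`.  Twin of the tree's `oneLinkKRModulus_su2` with the `SU(2)` variance lemma
replaced by the schema. [cite: arXiv220412737, Lemma 4.1 with (4.4)-(4.6) and Rem. 1.3] -/
theorem oneLinkKRModulus_of_varianceBound {N : ℕ} (hN : 2 ≤ N) {R v : ℝ} (hR : R < 1 / 2) (hv0 : 0 ≤ v)
    (hv : OneLinkVarianceBound N R v) :
    OneLinkKRModulus N R (Real.sqrt (v / ((N : ℝ) * (1 / 2 - R)))) := by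
  classical
  intro B B' hB hB' φ L hφm hφb hL hφL
  have hN0 : (0 : ℝ) < N := by exact_mod_cast (show 0 < N by omega)
  have h12 : 0 < 1 / 2 - R := by linarith
  have hKd : 0 < (N : ℝ) * (1 / 2 - R) := mul_pos hN0 h12
  have hKc0 : 0 ≤ Real.sqrt (v / ((N : ℝ) * (1 / 2 - R))) := Real.sqrt_nonneg _
  have hKc2 : Real.sqrt (v / ((N : ℝ) * (1 / 2 - R))) ^ 2 = v / ((N : ℝ) * (1 / 2 - R)) :=
    Real.sq_sqrt (div_nonneg hv0 hKd.le)
  -- the potentials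
  have hfw : (fun g : Matrix.specialUnitaryGroup (Fin N) ℂ =>
      (N : ℝ) * ((g : Matrix (Fin N) (Fin N) ℂ) * B').trace.re) =
      fun g : Matrix.specialUnitaryGroup (Fin N) ℂ => (N : ℝ) * ((g : Matrix (Fin N) (Fin N) ℂ) * B).trace.re +
        (N : ℝ) * ((g : Matrix (Fin N) (Fin N) ℂ) * (B' - B)).trace.re := by
    funext g
    simp only [Matrix.mul_sub, Matrix.trace_sub, Complex.sub_re]
    ring
  rw [hfw, abs_sub_comm]
  have hfm : Measurable fun g : Matrix.specialUnitaryGroup (Fin N) ℂ =>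
      (N : ℝ) * ((g : Matrix (Fin N) (Fin N) ℂ) * B).trace.re :=
    (continuous_const.mul (continuous_re_trace_su_mul B)).measurable
  have hwm : Measurable fun g : Matrix.specialUnitaryGroup (Fin N) ℂ =>
      (N : ℝ) * ((g : Matrix (Fin N) (Fin N) ℂ) * (B' - B)).trace.re :=
    (continuous_const.mul (continuous_re_trace_su_mul (B' - B))).measurable
  have hfb : ∃ C, ∀ s : Matrix.specialUnitaryGroup (Fin N) ℂ,
      |(N : ℝ) * ((s : Matrix (Fin N) (Fin N) ℂ) * B).trace.re| ≤ C :=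
    ⟨(N : ℝ) * (Real.sqrt N * frobNorm B), fun s => by
      rw [abs_mul, abs_of_nonneg hN0.le]
      exact mul_le_mul_of_nonneg_left (abs_re_trace_su_mul_le s B) hN0.le⟩
  have hwb : ∀ s : Matrix.specialUnitaryGroup (Fin N) ℂ,
      |(N : ℝ) * ((s : Matrix (Fin N) (Fin N) ℂ) * (B' - B)).trace.re| ≤
        (N : ℝ) * (Real.sqrt N * frobNorm (B' - B)) := fun s => by
    rw [abs_mul, abs_of_nonneg hN0.le]
    exact mul_le_mul_of_nonneg_left (abs_re_trace_su_mul_le s _) hN0.le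
  have key := abs_integral_tilted_add_sub_le_of_cov
    (μ := haarProbability (Matrix.specialUnitaryGroup (Fin N) ℂ))
    (A := Real.sqrt (v / ((N : ℝ) * (1 / 2 - R))) * L * frobNorm (B' - B)) hfm hfb hwm hwb hφm hφb ?_
  · rw [frobNorm_sub_comm]; exact key
  · intro t ht
    -- the interpolated tilt is the one-link law at `B_t`, `‖B_t‖_op ≤ R`
    set Bt : Matrix (Fin N) (Fin N) ℂ := B + (t : ℂ) • (B' - B) with hBt
    have hft : (fun u : Matrix.specialUnitaryGroup (Fin N) ℂ =>
        (N : ℝ) * ((u : Matrix (Fin N) (Fin N) ℂ) * B).trace.re +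
          t * ((N : ℝ) * ((u : Matrix (Fin N) (Fin N) ℂ) * (B' - B)).trace.re)) =
        fun g : Matrix.specialUnitaryGroup (Fin N) ℂ => (N : ℝ) * ((g : Matrix (Fin N) (Fin N) ℂ) * Bt).trace.re := by
      funext g
      simp only [hBt, Matrix.mul_add, Matrix.mul_smul, Matrix.trace_add, Matrix.trace_smul, Complex.add_re,
        smul_eq_mul, Complex.re_ofReal_mul]
      ring
    have hBt_le : matrixOpNorm Bt ≤ R := by
      have h1 : Bt = ((1 - t : ℝ) : ℂ) • B + ((t : ℝ) : ℂ) • B' := by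
        rw [hBt]
        push_cast
        simp only [smul_sub, sub_smul, one_smul]
        abel
      rw [h1]
      calc matrixOpNorm (((1 - t : ℝ) : ℂ) • B + ((t : ℝ) : ℂ) • B')
          ≤ matrixOpNorm (((1 - t : ℝ) : ℂ) • B) + matrixOpNorm (((t : ℝ) : ℂ) • B') := matrixOpNorm_add_le _ _
        _ = (1 - t) * matrixOpNorm B + t * matrixOpNorm B' := by
            rw [matrixOpNorm_smul, matrixOpNorm_smul, Complex.norm_real, Complex.norm_real, Real.norm_eq_abs,
              Real.norm_eq_abs, abs_of_nonneg (by linarith [ht.2]), abs_of_nonneg ht.1]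
        _ ≤ (1 - t) * R + t * R :=
            add_le_add (mul_le_mul_of_nonneg_left hB (by linarith [ht.2])) (mul_le_mul_of_nonneg_left hB' ht.1)
        _ = R := by ring
    have hBt_lt : matrixOpNorm Bt < 1 / 2 := by linarith
    rw [hft]
    set F : Matrix.specialUnitaryGroup (Fin N) ℂ → ℝ :=
      fun g => (N : ℝ) * ((g : Matrix (Fin N) (Fin N) ℂ) * Bt).trace.re with hFdef
    set ν : Measure (Matrix.specialUnitaryGroup (Fin N) ℂ) :=
      Measure.tilted (haarProbability (Matrix.specialUnitaryGroup (Fin N) ℂ)) F with hν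
    have hFm : Measurable F := (continuous_const.mul (continuous_re_trace_su_mul Bt)).measurable
    have hFb : ∀ s, |F s| ≤ (N : ℝ) * (Real.sqrt N * frobNorm Bt) := fun s => by
      simp only [hFdef]
      rw [abs_mul, abs_of_nonneg hN0.le]
      exact mul_le_mul_of_nonneg_left (abs_re_trace_su_mul_le s Bt) hN0.le
    have hexpF : Integrable (fun s => exp (F s)) (haarProbability (Matrix.specialUnitaryGroup (Fin N) ℂ)) :=
      integrable_of_measurable_of_abs_le hFm.exp (C := exp ((N : ℝ) * (Real.sqrt N * frobNorm Bt))) fun s => by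
        rw [abs_of_nonneg (exp_pos _).le]; exact exp_le_exp.2 ((le_abs_self _).trans (hFb s))
    haveI : IsProbabilityMeasure ν := isProbabilityMeasure_tilted hexpF
    -- the variance of the test function: Bakry–Émery
    have hVφ : ∫ s, (φ s - ∫ s', φ s' ∂ν) ^ 2 ∂ν ≤ L ^ 2 / ((N : ℝ) * (1 / 2 - R)) := by
      have hvar := SUNBakryEmery.haarPoincare_SU hN Bt hBt_lt φ L hL hφL
      rw [variance_eq_integral hφm.aemeasurable] at hvar
      refine hvar.trans ?_
      refine div_le_div_of_nonneg_left (sq_nonneg L) hKd ?_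
      exact mul_le_mul_of_nonneg_left (by linarith) hN0.le
    -- the variance of the linear observable: the HYPOTHESIS at `B_t`
    have hVw : ∫ s, ((N : ℝ) * ((s : Matrix (Fin N) (Fin N) ℂ) * (B' - B)).trace.re -
        ∫ s', (N : ℝ) * ((s' : Matrix (Fin N) (Fin N) ℂ) * (B' - B)).trace.re ∂ν) ^ 2 ∂ν ≤
        (Real.sqrt (v / ((N : ℝ) * (1 / 2 - R))) * ((N : ℝ) * (1 / 2 - R)) * frobNorm (B' - B)) ^ 2 /
          ((N : ℝ) * (1 / 2 - R)) := by
      have hvt := hv Bt hBt_le (B' - B)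
      rw [variance_eq_integral hwm.aemeasurable] at hvt
      have hM : (Real.sqrt (v / ((N : ℝ) * (1 / 2 - R))) * ((N : ℝ) * (1 / 2 - R)) * frobNorm (B' - B)) ^ 2 /
          ((N : ℝ) * (1 / 2 - R)) = v * frobNorm (B' - B) ^ 2 := by
        rw [mul_pow, mul_pow, hKc2]
        have e0 : v / ((N : ℝ) * (1 / 2 - R)) * ((N : ℝ) * (1 / 2 - R)) = v := div_mul_cancel₀ _ hKd.ne'
        calc v / ((N : ℝ) * (1 / 2 - R)) * ((N : ℝ) * (1 / 2 - R)) ^ 2 * frobNorm (B' - B) ^ 2 /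
              ((N : ℝ) * (1 / 2 - R))
            = v / ((N : ℝ) * (1 / 2 - R)) * ((N : ℝ) * (1 / 2 - R)) * frobNorm (B' - B) ^ 2 *
                (((N : ℝ) * (1 / 2 - R)) / ((N : ℝ) * (1 / 2 - R))) := by ring
          _ = v * frobNorm (B' - B) ^ 2 := by rw [e0, div_self hKd.ne', mul_one]
      rw [hM]
      exact hvt
    -- Cauchy–Schwarz
    have hcov := abs_integral_mul_sub_le_of_variance_le (ν := ν) hKd hL
      (mul_nonneg (mul_nonneg hKc0 hKd.le) (frobNorm_nonneg _)) hφm hφb hwm ⟨_, hwb⟩ hVφ hVw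
    refine hcov.trans (le_of_eq ?_)
    calc L * (Real.sqrt (v / ((N : ℝ) * (1 / 2 - R))) * ((N : ℝ) * (1 / 2 - R)) * frobNorm (B' - B)) /
          ((N : ℝ) * (1 / 2 - R))
        = Real.sqrt (v / ((N : ℝ) * (1 / 2 - R))) * L * frobNorm (B' - B) *
            (((N : ℝ) * (1 / 2 - R)) / ((N : ℝ) * (1 / 2 - R))) := by ring
      _ = Real.sqrt (v / ((N : ℝ) * (1 / 2 - R))) * L * frobNorm (B' - B) := by rw [div_self hKd.ne', mul_one]

/-- Consistency (a real-number identity): with the Bakry–Émery value `v = N/(1/2 − R)` the variance modulus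
`√(v/(N(1/2 − R)))` IS the tree's modulus `1/(1/2 − R)` of `oneLinkKRModulus_SU` — unconditionally the variance door
moves nothing (used in `su3_latticeMassGap_lt_again`). [folklore] -/
theorem varianceModulus_bakryEmery_eq {N : ℕ} (hN : 1 ≤ N) {R : ℝ} (hR : R < 1 / 2) :
    Real.sqrt ((N : ℝ) / (1 / 2 - R) / ((N : ℝ) * (1 / 2 - R))) = 1 / (1 / 2 - R) := by
  have hN0 : (0 : ℝ) < N := by exact_mod_cast (show 0 < N by omega)
  have h12 : 0 < 1 / 2 - R := by linarith
  have e : (N : ℝ) / (1 / 2 - R) / ((N : ℝ) * (1 / 2 - R)) = (1 / (1 / 2 - R)) ^ 2 := by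
    field_simp
  rw [e, Real.sqrt_sq (one_div_pos.2 h12).le]

/-! ## 2. The three doors fed with any modulus, and with the variance modulus -/

/-- **The three gauge-fixed doors for `SU(N)` with an arbitrary one-link modulus** `OneLinkKRModulus N R K` on a ball
`R ≥ 6β/N` (tree coupling `β ≥ 0`, 't Hooft `β/N`): SC-a if `18 (β/N) K < 1` (`dlrMassGapAt_of_oneLinkKRModulus`),
SC-b if `(14223/1000) (β/N) K < 1` (`strongCouplingFront_of_oneLinkKRModulus_sixteenClass`), SC-c if `14 (β/N) K < 1`
(`latticeMassGap_of_oneLinkKRModulus_axial`). [cite: Follmer1988, Ch. I Theorem (2.13)] -/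
theorem strongCouplingFronts_SU_of_modulus {N : ℕ} (hN : 2 ≤ N) {β R K : ℝ} (h0 : 0 ≤ β) (hK : 0 ≤ K)
    (hR : β / N * 6 ≤ R) (hmod : OneLinkKRModulus N R K) :
    (18 * (β / N) * K < 1 → DLRMassGapAt 4 N (β / N)) ∧
      (14223 / 1000 * (β / N) * K < 1 → CrossoverLedger.StrongCouplingFront (fundamentalLatticeRep N) β) ∧
        (14 * (β / N) * K < 1 →
          CrossoverLedger.LatticeMassGap (fundamentalRep (Fin N)) β (krRate (14 * (β / N) * K))) := by
  have hN0 : (0 : ℝ) < N := by exact_mod_cast (show 0 < N by omega)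
  have hx : 0 ≤ β / N := div_nonneg h0 hN0.le
  refine ⟨fun h => ?_, fun h => strongCouplingFront_of_oneLinkKRModulus_sixteenClass (by omega) hK hR hmod h,
    fun h => ?_⟩
  · refine dlrMassGapAt_of_oneLinkKRModulus (d := 4) (N := N) (by norm_num) hN hK ?_ hmod ?_
    · rw [abs_of_nonneg hx]; push_cast; linarith
    · rw [abs_of_nonneg hx]; push_cast; linarith
  · have hβa : |β| = β := abs_of_nonneg h0
    exact latticeMassGap_of_oneLinkKRModulus_axial (by omega) hK (by rw [hβa]; exact hR) hmod (by rw [hβa]) h h0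

/-- **The three doors with the variance modulus**: `OneLinkVarianceBound N (6β/N) v` with `6β/N < 1/2` gives SC-a /
SC-b / SC-c at tree coupling `β` as soon as `D (β/N) √(v/(N(1/2 − 6β/N))) < 1`, `D = 18 ∕ 14223/1000 ∕ 14`.
[folklore] -/
theorem strongCouplingFronts_SU_of_varianceBound {N : ℕ} (hN : 2 ≤ N) {β v : ℝ} (h0 : 0 ≤ β) (hv0 : 0 ≤ v)
    (hR : β / N * 6 < 1 / 2) (hv : OneLinkVarianceBound N (β / N * 6) v) :
    (18 * (β / N) * Real.sqrt (v / ((N : ℝ) * (1 / 2 - β / N * 6))) < 1 → DLRMassGapAt 4 N (β / N)) ∧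
      (14223 / 1000 * (β / N) * Real.sqrt (v / ((N : ℝ) * (1 / 2 - β / N * 6))) < 1 →
          CrossoverLedger.StrongCouplingFront (fundamentalLatticeRep N) β) ∧
        (14 * (β / N) * Real.sqrt (v / ((N : ℝ) * (1 / 2 - β / N * 6))) < 1 →
          CrossoverLedger.LatticeMassGap (fundamentalRep (Fin N)) β
            (krRate (14 * (β / N) * Real.sqrt (v / ((N : ℝ) * (1 / 2 - β / N * 6)))))) :=
  strongCouplingFronts_SU_of_modulus hN h0 (Real.sqrt_nonneg _) le_rfl (oneLinkKRModulus_of_varianceBound hN hR hv0 hv)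

/-- Squared form of a door inequality: `a ≥ 0`, `a² q < 1 ⟹ a √q < 1`. [folklore] -/
theorem mul_sqrt_lt_one {a q : ℝ} (ha : 0 ≤ a) (h : a ^ 2 * q < 1) : a * Real.sqrt q < 1 := by
  have e : a * Real.sqrt q = Real.sqrt (a ^ 2 * q) := by
    rw [Real.sqrt_mul (sq_nonneg a), Real.sqrt_sq ha]
  rw [e, Real.sqrt_lt' one_pos, one_pow]
  exact h

/-! ## 3. `SU(3)`: what a certified variance bound would give (CONDITIONAL, hypothesis displayed) -/

/-- **`SU(3)`, CONDITIONAL**: IF the one-link variance bound holds on the ball `‖B‖_op ≤ 6/25` with constant `111/50`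
(`= (3/2)(1 + 2·0.24)`, the Monte Carlo envelope; NOT proved, NOT evidence) THEN at Wilson `β_W = 0.36 = 6/g²` (tree
coupling `0.12`, 't Hooft `0.04`) the volume-uniform front SC-b and the transfer-matrix gap SC-c hold — against the
hypothesis-free `β_W < 0.2225 ∕ 0.225` of `StrongCouplingSUNFronts`.  Door arithmetic: `(14223/1000 · 1/25)² ·
(111/50)/(3 · 13/50) = 0.921 < 1` and `(14/25)² · 2.846 = 0.893 < 1`. [folklore] -/
theorem su3_fronts_036_of_varianceBound (hv : OneLinkVarianceBound 3 (6 / 25) (111 / 50)) :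
    CrossoverLedger.StrongCouplingFront (fundamentalLatticeRep 3) ((36 / 100 : ℝ) / 3) ∧
      CrossoverLedger.LatticeMassGap (fundamentalRep (Fin 3)) ((36 / 100 : ℝ) / 3)
        (krRate (14 * ((36 / 100 : ℝ) / 3 / 3) * Real.sqrt ((111 / 50) / ((3 : ℝ) * (1 / 2 - 6 / 25))))) := by
  have e : (36 / 100 : ℝ) / 3 / ((3 : ℕ) : ℝ) * 6 = 6 / 25 := by push_cast; norm_num
  have h := strongCouplingFronts_SU_of_varianceBound (N := 3) (β := (36 / 100 : ℝ) / 3) (v := 111 / 50) (by norm_num)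
    (by norm_num) (by norm_num) (by rw [e]; norm_num) (by rw [e]; exact hv)
  rw [e] at h
  have e3 : ((3 : ℕ) : ℝ) = 3 := by norm_num
  rw [e3] at h
  refine ⟨h.2.1 (mul_sqrt_lt_one (by norm_num) (by norm_num)),
    h.2.2 (mul_sqrt_lt_one (by norm_num) (by norm_num))⟩

/-- **`SU(3)`, CONDITIONAL**: IF `OneLinkVarianceBound 3 (21/100) (213/100)` (`213/100 = (3/2)(1 + 2·0.21)`, Monte
Carlo envelope; NOT proved) THEN SC-a (unique DLR state, clustering) at Wilson `β_W = 0.315` ('t Hooft `0.035`) —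
against the hypothesis-free (and printed) `β_W < 3/16 = 0.1875`.  Door arithmetic: `(18 · 0.035)² · (213/100)/(3 · 0.29)
= 0.971 < 1`. [folklore] -/
theorem su3_dlrMassGapAt_0315_of_varianceBound (hv : OneLinkVarianceBound 3 (21 / 100) (213 / 100)) :
    DLRMassGapAt 4 3 ((315 / 1000 : ℝ) / 9) := by
  have e : (315 / 1000 : ℝ) / 3 / ((3 : ℕ) : ℝ) * 6 = 21 / 100 := by push_cast; norm_num
  have h := strongCouplingFronts_SU_of_varianceBound (N := 3) (β := (315 / 1000 : ℝ) / 3) (v := 213 / 100)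
    (by norm_num) (by norm_num) (by norm_num) (by rw [e]; norm_num) (by rw [e]; exact hv)
  rw [e] at h
  have e3 : ((3 : ℕ) : ℝ) = 3 := by norm_num
  rw [e3] at h
  have e9 : (315 / 1000 : ℝ) / 3 / 3 = 315 / 1000 / 9 := by norm_num
  rw [e9] at h
  exact h.1 (mul_sqrt_lt_one (by norm_num) (by norm_num))

/-- The hypothesis-free windows are the `v = N/(1/2 − R)` case of the variance door: e.g. SC-c for `SU(3)` below
`β_W = 9/40` again, through `oneLinkKRModulus_of_varianceBound` ∘ `oneLinkVarianceBound_bakryEmery` and the identity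
`varianceModulus_bakryEmery_eq`. [folklore] -/
theorem su3_latticeMassGap_lt_again {βW : ℝ} (h0 : 0 ≤ βW) (h : βW < 9 / 40) :
    CrossoverLedger.LatticeMassGap (fundamentalRep (Fin 3)) (βW / 3)
      (krRate (14 * (βW / 3 / ((3 : ℕ) : ℝ)) * (1 / (1 / 2 - βW / 3 / ((3 : ℕ) : ℝ) * 6)))) := by
  have hR : βW / 3 / ((3 : ℕ) : ℝ) * 6 < 1 / 2 := by push_cast; linarith
  have hpos : 0 < 1 / 2 - βW / 3 / ((3 : ℕ) : ℝ) * 6 := by linarith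
  have hmod := oneLinkKRModulus_of_varianceBound (N := 3) (by norm_num) hR (div_nonneg (by norm_num) hpos.le)
    (oneLinkVarianceBound_bakryEmery (N := 3) (by norm_num) hR)
  rw [varianceModulus_bakryEmery_eq (N := 3) (by norm_num) hR] at hmod
  have h' := strongCouplingFronts_SU_of_modulus (N := 3) (β := βW / 3) (by norm_num) (by positivity)
    (le_of_lt (one_div_pos.2 hpos)) le_rfl hmod
  refine h'.2.2 ?_
  rw [← mul_div_assoc, mul_one, div_lt_one hpos]
  push_cast
  linarith

/-- Numbers of §3: the envelope values and the door arithmetic. [folklore] -/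
theorem su3_varianceDoor_numbers :
    (111 / 50 : ℝ) = 3 / 2 * (1 + 2 * (6 / 25)) ∧ (213 / 100 : ℝ) = 3 / 2 * (1 + 2 * (21 / 100)) ∧
      (14223 / 1000 * (1 / 25) : ℝ) ^ 2 * ((111 / 50) / (3 * (1 / 2 - 6 / 25))) < 1 ∧
      (14 * (1 / 25) : ℝ) ^ 2 * ((111 / 50) / (3 * (1 / 2 - 6 / 25))) < 1 ∧
      (18 * (35 / 1000) : ℝ) ^ 2 * ((213 / 100) / (3 * (1 / 2 - 21 / 100))) < 1 ∧
      ¬ (18 * (1 / 25) : ℝ) ^ 2 * ((111 / 50) / (3 * (1 / 2 - 6 / 25))) < 1 ∧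
      (9 : ℝ) / 40 < 315 / 1000 ∧ (315 : ℝ) / 1000 < 36 / 100 := by
  norm_num

end Summit.QuantumFields.BalabanUV.InfraRed.StrongCouplingVarianceDoorSUN
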